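import Summits.ValiantsHypothesis.ValiantsHypothesis.Theorems.LacunarySymmetroidMatrixDescartesFiniteSector
import Summits.ValiantsHypothesis.ValiantsHypothesis.Theorems.LacunarySymmetroidMatrixDescartesStubBlockSector

/-!
# `MatrixDescartes` — line «finite»: FORMAT MONOTONICITY of the finite registers `η(m,K)` (sector) and `ν(m,K)` (stamp)

HONEST FRAMING.  Object-search cell `pub-symmetroid`, seat val-sym-door-p5 g10.  HELPER of the crux item `stmt-ValiantsHypothesis-18050`
(`Theses.LacunarySymmetroid.MatrixDescartes`) with NO closure claim; elementary bookkeeping, the finite-register companion of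
`…CensusFormatMonotone` (which does the same for the census rows `ζ(m,K)`, `M(m,K)`; not imported — it sits above the route file — its zero-padding
lemma is re-proved here in `pencil` notation, the symmetry of the padding inlined — `Census.isSymm_append_zero` is the landed form).  The kernel table of line «finite»
(`HypRootLawAt m K σ`, `StampLawAt m K n`, cells up to `(21,4)`, `(14,5)`, `(7,6)`, `(2,11)` …) is a table of SINGLE cells; this file
records how a cell propagates:

* §1 **Bound monotonicity** (`hypRootLawAt_mono`, `stampLawAt_mono`): `B ≤ B'`.
* §2 **Term monotonicity** (`hypRootLawAt_of_le_terms`, `stampLawAt_of_le_terms`): a row with `K'` terms gives the row with every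
  `K ≤ K'` terms (pad with zero coefficients — the pencil is unchanged; `pencil_append_zero`).  So `η(m,K)` and `ν(m,K)` are
  monotone in `K`.
* §3 **Size monotonicity** (`stampLawAt_of_le_size`, `hypRootLawAt_of_le_size`): a row at size `m'` gives the row at every size
  `m ≤ m'` — for the stamp register unconditionally, for the sector register when `2 ≤ m` and `1 ≤ B`.  The census padding of
  `…CensusFormatMonotone` (an identity block, `det ↦ det · (∑ X^{d l})^n`) is useless here because it raises the degree; instead every
  coefficient `S l` is padded with the block `[l = l₀]·1` for an exponent `d l₀ = 0`, which leaves the determinant UNCHANGED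
  (`det_pencil_padDelta`).  Such an exponent exists whenever the register hypothesis is non-vacuous: a full-positive-rooted
  `det ≠ 0` has a non-zero constant coefficient (T3, `mem_sumset_of_fullPos` at `r = 0`), and an in-sector `det ≠ 0` of degree `≥ 2` at
  size `m ≥ 2` has `0` or `1` among its `m`-fold exponent sums (the sieve at `r = 0`), forcing a zero exponent.  (At `m = 1` the sector
  register is NOT size-monotone: `d = (1)`, `S = (1)` gives `det = X`, in the sector with degree `1`, while every `1`-term pencil of
  size `2` in the sector is constant — hence the hypothesis `2 ≤ m`; `1 ≤ B` disposes of degrees `≤ 1`, where the sieve says nothing.)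

Consequence (by name, no new computation): every landed cell bounds all smaller formats, e.g. `StampLawAt 21 4 805` (p669658) gives
`StampLawAt m K 805` for all `m ≤ 21`, `K ≤ 4` — weaker than the exact smaller cells, but it makes the kernel table a monotone table.
Nothing here bears on the crux (asymptotic in `K`), on the doors, or on `VP ≠ VNP`.
[folklore] Elementary (block determinants, `Polynomial.roots`); no citation is load-bearing.
-/

-- `Summit.ValiantsHypothesis.ValiantsHypothesis.…` repeats a component by the D-0017 layout
-- (single-conjunct summit), which the `dupNamespace` linter flags; the name is mandated.
set_option linter.dupNamespace false

namespace Summit.ValiantsHypothesis.ValiantsHypothesis.Theorems.LacunarySymmetroidMatrixDescartes.FiniteSector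

open scoped BigOperators Matrix
open Polynomial

/-! ## §1 Bound monotonicity -/

/-- `HypRootLawAt m K B → HypRootLawAt m K B'` for `B ≤ B'`. [folklore] -/
theorem hypRootLawAt_mono {m K B B' : ℕ} (hBB' : B ≤ B') (h : HypRootLawAt m K B) : HypRootLawAt m K B' :=
  fun d S hS hsec => (h d S hS hsec).trans hBB'

/-- `StampLawAt m K B → StampLawAt m K B'` for `B ≤ B'`. [folklore] -/
theorem stampLawAt_mono {m K B B' : ℕ} (hBB' : B ≤ B') (h : StampLawAt m K B) : StampLawAt m K B' :=
  fun d S hS hfull => (h d S hS hfull).trans hBB'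

/-! ## §2 Term monotonicity: pad with zero coefficients -/

/-- Appending zero coefficients (on arbitrary exponents) does not change the pencil (as `Census.pencil_append_zero` of
`…CensusFormatMonotone`, in `pencil` notation). [folklore] -/
theorem pencil_append_zero {m K j : ℕ} (d : Fin K → ℕ) (S : Fin K → Matrix (Fin m) (Fin m) ℝ) (d₂ : Fin j → ℕ) :
    pencil (Fin.append d d₂) (Fin.append S (fun _ : Fin j => (0 : Matrix (Fin m) (Fin m) ℝ))) = pencil d S := by
  simp only [pencil]
  rw [Fin.sum_univ_add]
  simp only [Fin.append_left, Fin.append_right, Matrix.map_zero _ Polynomial.C_0, smul_zero,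
    Finset.sum_const_zero, add_zero]


/-- **Term monotonicity, sector register**: `HypRootLawAt m K' B → HypRootLawAt m K B` for `K ≤ K'`; so `η(m,K)` is monotone
in `K`. [folklore] -/
theorem hypRootLawAt_of_le_terms {m K K' B : ℕ} (hK : K ≤ K') (h : HypRootLawAt m K' B) : HypRootLawAt m K B := by
  obtain ⟨j, rfl⟩ := Nat.exists_eq_add_of_le hK
  intro d S hS hsec
  have h1 := h (Fin.append d (fun _ : Fin j => 0)) (Fin.append S (fun _ : Fin j => 0))
    (fun l => by
      induction l using Fin.addCases with
      | left i => rw [Fin.append_left]; exact hS i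
      | right i => rw [Fin.append_right]; exact Matrix.isSymm_zero)
  rw [pencil_append_zero] at h1
  exact h1 hsec

/-- **Term monotonicity, stamp register**: `StampLawAt m K' B → StampLawAt m K B` for `K ≤ K'`; so `ν(m,K)` is monotone
in `K`. [folklore] -/
theorem stampLawAt_of_le_terms {m K K' B : ℕ} (hK : K ≤ K') (h : StampLawAt m K' B) : StampLawAt m K B := by
  obtain ⟨j, rfl⟩ := Nat.exists_eq_add_of_le hK
  intro d S hS hfull
  have h1 := h (Fin.append d (fun _ : Fin j => 0)) (Fin.append S (fun _ : Fin j => 0))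
    (fun l => by
      induction l using Fin.addCases with
      | left i => rw [Fin.append_left]; exact hS i
      | right i => rw [Fin.append_right]; exact Matrix.isSymm_zero)
  rw [pencil_append_zero] at h1
  exact h1 hfull

/-! ## §3 Size monotonicity: pad with the block `[l = l₀]·1` at a zero exponent -/

/-- **Delta padding.**  Padding every coefficient `S l` with the `n × n` block `[l = l₀]·1` multiplies the determinant of the
pencil by `(X^(d l₀))^n`. [folklore] -/
theorem det_pencil_padDelta {m n K : ℕ} (d : Fin K → ℕ) (S : Fin K → Matrix (Fin m) (Fin m) ℝ) (l₀ : Fin K) :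
    (pencil d (fun l => Matrix.reindex finSumFinEquiv finSumFinEquiv
        (Matrix.fromBlocks (S l) 0 0 (if l = l₀ then (1 : Matrix (Fin n) (Fin n) ℝ) else 0)))).det
      = (pencil d S).det * (((Polynomial.X : ℝ[X]) ^ d l₀) ^ n) := by
  have h1 : (pencil d (fun l => Matrix.reindex finSumFinEquiv finSumFinEquiv
        (Matrix.fromBlocks (S l) 0 0 (if l = l₀ then (1 : Matrix (Fin n) (Fin n) ℝ) else 0))))
      = Matrix.reindex finSumFinEquiv finSumFinEquiv
          (∑ l, ((Polynomial.X : ℝ[X]) ^ d l) •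
            (Matrix.fromBlocks (S l) 0 0 (if l = l₀ then (1 : Matrix (Fin n) (Fin n) ℝ) else 0)).map Polynomial.C) := by
    ext i j
    simp only [pencil, Matrix.reindex_apply, Matrix.submatrix_apply, Matrix.sum_apply, Matrix.smul_apply,
      Matrix.map_apply]
  have h2 : (∑ l, ((Polynomial.X : ℝ[X]) ^ d l) •
        ((if l = l₀ then (1 : Matrix (Fin n) (Fin n) ℝ) else 0).map Polynomial.C))
      = ((Polynomial.X : ℝ[X]) ^ d l₀) • (1 : Matrix (Fin n) (Fin n) ℝ[X]) := by
    have h3 : ∀ l : Fin K, ((Polynomial.X : ℝ[X]) ^ d l) •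
        ((if l = l₀ then (1 : Matrix (Fin n) (Fin n) ℝ) else 0).map Polynomial.C)
          = if l = l₀ then ((Polynomial.X : ℝ[X]) ^ d l₀) • (1 : Matrix (Fin n) (Fin n) ℝ[X]) else 0 := by
      intro l
      split_ifs with hl
      · rw [hl, Matrix.map_one Polynomial.C (map_zero _) (map_one _)]
      · rw [Matrix.map_zero _ (map_zero _), smul_zero]
    rw [Finset.sum_congr rfl (fun l _ => h3 l), Finset.sum_ite_eq' Finset.univ l₀]
    simp
  rw [h1, Matrix.det_reindex_self, StubBlockSector.sum_smul_fromBlocks_map, Matrix.det_fromBlocks_zero₂₁, h2,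
    Matrix.det_smul, Matrix.det_one, mul_one, Fintype.card_fin]

/-- The delta-padded coefficients are symmetric. [folklore] -/
theorem isSymm_padDelta {m n K : ℕ} {S : Fin K → Matrix (Fin m) (Fin m) ℝ} (hS : ∀ l, (S l).IsSymm) (l₀ l : Fin K) :
    (Matrix.reindex finSumFinEquiv finSumFinEquiv
      (Matrix.fromBlocks (S l) 0 0 (if l = l₀ then (1 : Matrix (Fin n) (Fin n) ℝ) else 0))).IsSymm := by
  refine (Matrix.IsSymm.fromBlocks (hS l) (by simp) ?_).submatrix _
  split_ifs
  · exact Matrix.isSymm_one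
  · exact Matrix.isSymm_zero

/-- **Delta padding at a zero exponent preserves the determinant.** [folklore] -/
theorem det_pencil_padDelta_of_zero {m n K : ℕ} (d : Fin K → ℕ) (S : Fin K → Matrix (Fin m) (Fin m) ℝ) (l₀ : Fin K)
    (h0 : d l₀ = 0) :
    (pencil d (fun l => Matrix.reindex finSumFinEquiv finSumFinEquiv
        (Matrix.fromBlocks (S l) 0 0 (if l = l₀ then (1 : Matrix (Fin n) (Fin n) ℝ) else 0)))).det
      = (pencil d S).det := by
  rw [det_pencil_padDelta, h0, pow_zero, one_pow, mul_one]

/-- A zero `m`-fold sum of exponents (`m ≥ 1`) exhibits a zero exponent. [folklore] -/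
theorem exists_exponent_zero_of_sum_zero {m K : ℕ} (hm : 0 < m) (d : Fin K → ℕ) (s : Sym (Fin K) m)
    (hs : ((s : Multiset (Fin K)).map d).sum = 0) : ∃ l₀ : Fin K, d l₀ = 0 := by
  have hcard : Multiset.card (s : Multiset (Fin K)) = m := s.2
  obtain ⟨l, hl⟩ : ∃ l, l ∈ (s : Multiset (Fin K)) :=
    Multiset.card_pos_iff_exists_mem.mp (by rw [hcard]; exact hm)
  exact ⟨l, Multiset.sum_eq_zero_iff.mp hs (d l) (Multiset.mem_map_of_mem d hl)⟩

/-- A sum `≤ 1` of `m ≥ 2` exponents exhibits a zero exponent. [folklore] -/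
theorem exists_exponent_zero_of_sum_le_one {m K : ℕ} (hm : 2 ≤ m) (d : Fin K → ℕ) (s : Sym (Fin K) m)
    (hs : ((s : Multiset (Fin K)).map d).sum ≤ 1) : ∃ l₀ : Fin K, d l₀ = 0 := by
  by_contra hne
  simp only [not_exists] at hne
  have hge : ∀ x ∈ (s : Multiset (Fin K)).map d, 1 ≤ x := by
    intro x hx
    obtain ⟨l, -, rfl⟩ := Multiset.mem_map.mp hx
    exact Nat.one_le_iff_ne_zero.mpr (hne l)
  have h1 := Multiset.card_nsmul_le_sum hge
  rw [Multiset.card_map] at h1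
  have hcard : Multiset.card (s : Multiset (Fin K)) = m := s.2
  rw [hcard, smul_eq_mul, mul_one] at h1
  omega

/-- **Size monotonicity, stamp register**: `StampLawAt m' K B → StampLawAt m K B` for `m ≤ m'`; so `ν(m,K)` is monotone
in `m`.  (A full-positive-rooted non-zero determinant has a non-zero constant coefficient, hence a zero exponent; pad there.)
[folklore] -/
theorem stampLawAt_of_le_size {m m' K B : ℕ} (hm : m ≤ m') (h : StampLawAt m' K B) : StampLawAt m K B := by
  obtain ⟨n, rfl⟩ := Nat.exists_eq_add_of_le hm
  intro d S hS hfull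
  by_cases hq : (pencil d S).det = 0
  · rw [hq, Polynomial.natDegree_zero]; exact Nat.zero_le _
  rcases Nat.eq_zero_or_pos m with hm0 | hm0
  · -- size 0: the determinant is the constant 1
    subst hm0
    have : (pencil d S).det = 1 := Matrix.det_isEmpty
    rw [this, Polynomial.natDegree_one]; exact Nat.zero_le _
  have hmem := mem_sumset_of_fullPos d S hq hfull (r := 0) (Nat.zero_le _)
  rw [Finset.mem_image] at hmem
  obtain ⟨s, -, hs⟩ := hmem
  obtain ⟨l₀, hl₀⟩ := exists_exponent_zero_of_sum_zero hm0 d s hs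
  have h1 := h d _ (isSymm_padDelta (n := n) hS l₀)
  rw [det_pencil_padDelta_of_zero d S l₀ hl₀] at h1
  exact h1 hfull

/-- **Size monotonicity, sector register**: `HypRootLawAt m' K B → HypRootLawAt m K B` for `2 ≤ m ≤ m'` and `1 ≤ B`; so
`η(m,K)` is monotone in `m ≥ 2`.  (An in-sector non-zero determinant of degree `≥ 2` has `0` or `1` among its `m`-fold exponent sums
by the sieve at `r = 0`; with `m ≥ 2` this forces a zero exponent; pad there.  Degrees `≤ 1` are covered by `1 ≤ B`.) [folklore] -/
theorem hypRootLawAt_of_le_size {m m' K B : ℕ} (hm2 : 2 ≤ m) (hm : m ≤ m') (hB : 1 ≤ B) (h : HypRootLawAt m' K B) :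
    HypRootLawAt m K B := by
  obtain ⟨n, rfl⟩ := Nat.exists_eq_add_of_le hm
  intro d S hS hsec
  by_cases hq : (pencil d S).det = 0
  · rw [hq, Polynomial.natDegree_zero]; exact Nat.zero_le _
  by_cases hdeg : (pencil d S).det.natDegree ≤ 1
  · exact hdeg.trans hB
  have hsv := sieve d S hq hsec (r := 0) (by show 0 + 2 ≤ (pencil d S).det.natDegree; omega)
  have key : ∃ l₀ : Fin K, d l₀ = 0 := by
    rcases hsv with h0 | h0 <;>
    · rw [Finset.mem_image] at h0
      obtain ⟨s, -, hs⟩ := h0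
      exact exists_exponent_zero_of_sum_le_one hm2 d s (by omega)
  obtain ⟨l₀, hl₀⟩ := key
  have h1 := h d _ (isSymm_padDelta (n := n) hS l₀)
  rw [det_pencil_padDelta_of_zero d S l₀ hl₀] at h1
  exact h1 hsec

end Summit.ValiantsHypothesis.ValiantsHypothesis.Theorems.LacunarySymmetroidMatrixDescartes.FiniteSector
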